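import Summits.AtomisticToContinuum.BoseEinsteinCondensation.Theses.BECThomsonPrinciple
import Literature.MathematicalPhysics.QuantumManyBody.SquareWellScatteringLength
import Literature.MathematicalPhysics.QuantumManyBody.PeriodicBoseGasThm31
import Literature.MathematicalPhysics.QuantumManyBody.BoseGasThermodynamicLimitRuelle
import Literature.MathematicalPhysics.QuantumManyBody.TorusFockSectorDictionary
import Literature.Probability.Distributions.GaussianPiDensity

/-!
# Negative lemmas for crux `DensityResponse` (stmt-AtomisticToContinuum-9481), I: the periodised
# square well is nearly constant in a small box

Supports (does not close) stmt-AtomisticToContinuum-9481 (crux `DensityResponse`, route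
`BECThomsonPrinciple`, rank 4).  Importable landed copy of the cdisprove seat's standing file
`Cruxes/DensityResponse/Disproof.lean` (generation 2), split by topic; `sorry`-free, standard axioms.
Nothing here asserts a `Theses` decl positively.

* §1 `latCount_le` / `le_latCount`: `ω(r−1)³ ≤ #(ℤ³ ∩ B(c,r)) ≤ ω(r+1)³`, `ω = |B₁| ≤ 8` (unit cubes
  around lattice points versus balls, `Measure.addHaar_closedBall'`).
* §2 `periodizedPotential_sqWell`: the periodised square well `K·1_{r≤R}` on the torus of side `L` is
  `K·latCount(x/L, R/L)`, hence squeezed in `[Kω(R/L−1)³, Kω(R/L+1)³]` — for `L ≪ R` every particle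
  sees `≈ (4π/3)(R/L)³` images of every other and `v^per` is CONSTANT up to a relative error `O(L/R)`.
* §3 `le_periodicGroundStateEnergy_of_le` (`E₀ ≥ #pairs · inf v^per`, kinetic energy dropped) and
  `periodicEnergy_le_of_pointwise` (`E(Ψ) ≤ t + #pairs · sup v^per` under a pointwise kinetic bound).
-/

noncomputable section

open MeasureTheory Set Filter Metric
open scoped ENNReal NNReal BigOperators Classical

namespace Summit.AtomisticToContinuum.BoseEinsteinCondensation.Theorems.DensityResponse.Negative

open Literature.MathematicalPhysics.QuantumManyBody.BoseGas

/-! ## §1 Lattice points in a ball -/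

/-- The integer point `m ∈ ℤ³ ⊂ ℝ³`. [folklore] -/
def intVec (m : Fin 3 → ℤ) : Space := WithLp.toLp 2 fun k => (m k : ℝ)

/-- Coordinates of an integer point. [folklore] -/
@[simp] theorem intVec_apply (m : Fin 3 → ℤ) (k : Fin 3) : intVec m k = (m k : ℝ) := rfl

/-- `L·m = L • m`. [folklore] -/
theorem latticeVec_eq_smul_intVec (L : ℝ) (m : Fin 3 → ℤ) : latticeVec L m = L • intVec m := by
  ext k
  simp [latticeVec, intVec]

/-- The half-open unit cube of `ℝ³` centred at the integer point `m`. [folklore] -/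
def intCube (m : Fin 3 → ℤ) : Set Space :=
  {x | ∀ k, x k - (m k : ℝ) ∈ Set.Ico (-(1 / 2 : ℝ)) (1 / 2)}

/-- The cubes are measurable. [folklore] -/
theorem measurableSet_intCube (m : Fin 3 → ℤ) : MeasurableSet (intCube m) := by
  have : intCube m = ⋂ k : Fin 3, (fun x : Space => x k - (m k : ℝ)) ⁻¹' Set.Ico (-(1 / 2 : ℝ)) (1 / 2) := by
    ext x; simp [intCube]
  rw [this]
  exact MeasurableSet.iInter fun k => measurableSet_Ico.preimage (by fun_prop)

/-- Each cube has volume `1`. [folklore] -/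
theorem volume_intCube (m : Fin 3 → ℤ) : volume (intCube m) = 1 := by
  have h : intCube m = WithLp.ofLp ⁻¹'
      (Set.univ.pi fun k : Fin 3 => Set.Ico ((m k : ℝ) - 1 / 2) ((m k : ℝ) + 1 / 2)) := by
    ext x
    simp only [intCube, Set.mem_Ico, Set.mem_setOf_eq, Set.mem_preimage, Set.mem_univ_pi]
    refine forall_congr' fun k => ?_
    constructor <;> rintro ⟨h1, h2⟩ <;> constructor <;> linarith
  rw [h, (PiLp.volume_preserving_ofLp (Fin 3)).measure_preimage
    (MeasurableSet.univ_pi fun _ => measurableSet_Ico).nullMeasurableSet, volume_pi_pi]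
  simp only [Real.volume_Ico]
  norm_num

/-- Distinct cubes are disjoint. [folklore] -/
theorem intCube_disjoint {m m' : Fin 3 → ℤ} (h : m ≠ m') : Disjoint (intCube m) (intCube m') := by
  rw [Set.disjoint_left]
  intro x hx hx'
  apply h
  funext k
  have h1 := hx k
  have h2 := hx' k
  simp only [Set.mem_Ico] at h1 h2
  have h3 : ((m k : ℤ) : ℝ) - (m' k : ℝ) < 1 := by linarith
  have h4 : (-1 : ℝ) < ((m k : ℤ) : ℝ) - (m' k : ℝ) := by linarith
  have h5 : (m k : ℤ) - m' k < 1 := by exact_mod_cast h3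
  have h6 : (-1 : ℤ) < m k - m' k := by exact_mod_cast h4
  omega

/-- Coordinatewise rounding puts every point in a cube. [folklore] -/
theorem mem_intCube_round (y : Space) : y ∈ intCube fun k => ⌊y k + 1 / 2⌋ := by
  intro k
  simp only [Set.mem_Ico]
  constructor
  · have := Int.floor_le (y k + 1 / 2); linarith
  · have := Int.lt_floor_add_one (y k + 1 / 2); linarith

/-- A point of the cube is within distance `1` of its centre (`√3/2 ≤ 1`). [folklore] -/
theorem norm_sub_intVec_le {m : Fin 3 → ℤ} {x : Space} (hx : x ∈ intCube m) : ‖x - intVec m‖ ≤ 1 := by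
  have hk : ∀ k, ‖(x - intVec m) k‖ ^ 2 ≤ 1 / 4 := by
    intro k
    rw [PiLp.sub_apply, intVec_apply, Real.norm_eq_abs, sq_abs]
    have := hx k
    simp only [Set.mem_Ico] at this
    nlinarith [this.1, this.2]
  have h2 : ‖x - intVec m‖ ^ 2 ≤ 1 := by
    rw [EuclideanSpace.norm_sq_eq]
    calc ∑ k, ‖(x - intVec m) k‖ ^ 2 ≤ ∑ _k : Fin 3, (1 / 4 : ℝ) := Finset.sum_le_sum fun k _ => hk k
      _ ≤ 1 := by simp; norm_num
  nlinarith [norm_nonneg (x - intVec m)]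

/-- The number of integer points in the closed ball `B(c, r)`, in `[0, ∞]`. [folklore] -/
def latCount (c : Space) (r : ℝ) : ℝ≥0∞ :=
  ∑' m : Fin 3 → ℤ, (closedBall c r).indicator (fun _ => (1 : ℝ≥0∞)) (intVec m)

/-- The count is the volume of the union of the cubes centred in the ball. [folklore] -/
theorem latCount_eq_volume (c : Space) (r : ℝ) :
    latCount c r = volume (⋃ m : Fin 3 → ℤ, if intVec m ∈ closedBall c r then intCube m else ∅) := by
  rw [measure_iUnion]
  · unfold latCount
    congr 1
    funext m
    by_cases hm : intVec m ∈ closedBall c r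
    · rw [Set.indicator_of_mem hm, if_pos hm, volume_intCube]
    · rw [Set.indicator_of_notMem hm, if_neg hm, measure_empty]
  · intro m m' hmm'
    simp only [Function.onFun]
    split_ifs
    · exact intCube_disjoint hmm'
    · exact Set.disjoint_empty _
    · exact Set.empty_disjoint _
    · exact Set.disjoint_empty _
  · intro m
    split_ifs
    · exact measurableSet_intCube m
    · exact MeasurableSet.empty

/-- **Upper count**: `#(ℤ³ ∩ B(c,r)) ≤ |B₁| (r+1)³`. [folklore] -/
theorem latCount_le (c : Space) {r : ℝ} (hr : 0 ≤ r) :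
    latCount c r ≤ ENNReal.ofReal ((r + 1) ^ 3) * volume (closedBall (0 : Space) 1) := by
  rw [latCount_eq_volume]
  have hsub : (⋃ m : Fin 3 → ℤ, if intVec m ∈ closedBall c r then intCube m else ∅) ⊆
      closedBall c (r + 1) := by
    intro x hx
    simp only [Set.mem_iUnion] at hx
    obtain ⟨m, hm⟩ := hx
    split_ifs at hm with h
    · rw [mem_closedBall] at h ⊢
      calc dist x c ≤ dist x (intVec m) + dist (intVec m) c := dist_triangle _ _ _
        _ ≤ 1 + r := add_le_add (by rw [dist_eq_norm]; exact norm_sub_intVec_le hm) h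
        _ = r + 1 := add_comm _ _
    · exact absurd hm (Set.notMem_empty x)
  calc volume _ ≤ volume (closedBall c (r + 1)) := measure_mono hsub
    _ = ENNReal.ofReal ((r + 1) ^ 3) * volume (closedBall (0 : Space) 1) := by
        rw [Measure.addHaar_closedBall' volume c (by linarith), finrank_euclideanSpace_fin]

/-- **Lower count**: `|B₁| (r-1)³ ≤ #(ℤ³ ∩ B(c,r))` for `r ≥ 1`. [folklore] -/
theorem le_latCount (c : Space) {r : ℝ} (hr : 1 ≤ r) :
    ENNReal.ofReal ((r - 1) ^ 3) * volume (closedBall (0 : Space) 1) ≤ latCount c r := by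
  rw [latCount_eq_volume]
  have hsub : closedBall c (r - 1) ⊆
      ⋃ m : Fin 3 → ℤ, if intVec m ∈ closedBall c r then intCube m else ∅ := by
    intro y hy
    have hym : y ∈ intCube (fun k => ⌊y k + 1 / 2⌋) := mem_intCube_round y
    have hmS : intVec (fun k => ⌊y k + 1 / 2⌋) ∈ closedBall c r := by
      rw [mem_closedBall] at hy ⊢
      calc dist (intVec fun k => ⌊y k + 1 / 2⌋) c
          ≤ dist (intVec fun k => ⌊y k + 1 / 2⌋) y + dist y c := dist_triangle _ _ _
        _ ≤ 1 + (r - 1) :=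
            add_le_add (by rw [dist_comm, dist_eq_norm]; exact norm_sub_intVec_le hym) hy
        _ = r := by ring
    simp only [Set.mem_iUnion]
    exact ⟨fun k => ⌊y k + 1 / 2⌋, by rw [if_pos hmS]; exact hym⟩
  calc ENNReal.ofReal ((r - 1) ^ 3) * volume (closedBall (0 : Space) 1)
        = volume (closedBall c (r - 1)) := by
          rw [Measure.addHaar_closedBall' volume c (by linarith), finrank_euclideanSpace_fin]
    _ ≤ _ := measure_mono hsub

/-- `|B₁| ≤ |[-1,1]³| = 8`. [folklore] -/
theorem volume_closedBall_one_le_eight : volume (closedBall (0 : Space) 1) ≤ 8 := by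
  have hsub : closedBall (0 : Space) 1 ⊆
      WithLp.ofLp ⁻¹' (Set.univ.pi fun _ : Fin 3 => Set.Icc (-1 : ℝ) 1) := by
    intro x hx
    rw [mem_closedBall, dist_zero_right] at hx
    simp only [Set.mem_preimage, Set.mem_univ_pi, Set.mem_Icc]
    intro k
    have := (PiLp.norm_apply_le x k).trans hx
    rw [Real.norm_eq_abs, abs_le] at this
    exact this
  calc volume (closedBall (0 : Space) 1)
      ≤ volume (WithLp.ofLp ⁻¹' (Set.univ.pi fun _ : Fin 3 => Set.Icc (-1 : ℝ) 1)) :=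
        measure_mono hsub
    _ = 8 := by
      rw [(PiLp.volume_preserving_ofLp (Fin 3)).measure_preimage
        (MeasurableSet.univ_pi fun _ => measurableSet_Icc).nullMeasurableSet, volume_pi_pi]
      simp only [Real.volume_Icc, Finset.prod_const, Finset.card_univ, Fintype.card_fin]
      norm_num

/-- The volume of the unit ball of `ℝ³`, as a real number (`= 4π/3`; only `0 ≤ ω₃ ≤ 8` is used).
[folklore] -/
def ω₃ : ℝ := (volume (closedBall (0 : Space) 1)).toReal

/-- `|B₁| = ofReal ω₃`. [folklore] -/
theorem volume_closedBall_one_eq : volume (closedBall (0 : Space) 1) = ENNReal.ofReal ω₃ := by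
  rw [ω₃, ENNReal.ofReal_toReal]
  exact ne_top_of_le_ne_top (by norm_num) volume_closedBall_one_le_eight

/-- `0 ≤ ω₃`. [folklore] -/
theorem ω₃_nonneg : 0 ≤ ω₃ := ENNReal.toReal_nonneg

/-- `ω₃ ≤ 8`. [folklore] -/
theorem ω₃_le_eight : ω₃ ≤ 8 := by
  have h := volume_closedBall_one_le_eight
  rw [volume_closedBall_one_eq] at h
  have : ENNReal.ofReal ω₃ ≤ ENNReal.ofReal 8 := by simpa using h
  exact (ENNReal.ofReal_le_ofReal_iff (by norm_num)).1 this

/-! ## §2 The periodised square well is nearly constant for `L ≪ R` -/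

/-- The finite spherical well of height `K` and radius `R` (the tree's square well). [folklore] -/
abbrev sqWell (K R : ℝ) : ℝ → ℝ≥0∞ := (Set.Iic R).indicator fun _ => ENNReal.ofReal K

/-- The square well is an admissible (repulsive, finite-range, measurable) potential. [folklore] -/
theorem isRepulsiveFiniteRange_sqWell (K R : ℝ) : IsRepulsiveFiniteRange (sqWell K R) :=
  ⟨measurable_squareWell K R, R, fun _ hr => squareWell_eq_zero hr⟩

/-- `v^per(x) = K · #{m ∈ ℤ³ : |x/L - m| ≤ R/L}`. [folklore] -/
theorem periodizedPotential_sqWell {K R L : ℝ} (hL : 0 < L) (x : Space) :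
    periodizedPotential (sqWell K R) L x = ENNReal.ofReal K * latCount (L⁻¹ • x) (R / L) := by
  unfold periodizedPotential latCount
  rw [← ENNReal.tsum_mul_left]
  congr 1
  funext m
  have hnorm : ‖x - latticeVec L m‖ = L * ‖L⁻¹ • x - intVec m‖ := by
    rw [latticeVec_eq_smul_intVec]
    have : x - L • intVec m = L • (L⁻¹ • x - intVec m) := by
      rw [smul_sub, smul_inv_smul₀ hL.ne']
    rw [this, norm_smul, Real.norm_of_nonneg hL.le]
  by_cases h : ‖L⁻¹ • x - intVec m‖ ≤ R / L
  · have h1 : ‖x - latticeVec L m‖ ∈ Set.Iic R := by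
      rw [Set.mem_Iic, hnorm]; rwa [le_div_iff₀' hL] at h
    have h2 : intVec m ∈ closedBall (L⁻¹ • x) (R / L) := by
      rw [mem_closedBall, dist_comm, dist_eq_norm]; exact h
    simp only [sqWell]
    rw [Set.indicator_of_mem h1, Set.indicator_of_mem h2, mul_one]
  · have h1 : ‖x - latticeVec L m‖ ∉ Set.Iic R := by
      rw [Set.mem_Iic, hnorm, ← le_div_iff₀' hL]; exact h
    have h2 : intVec m ∉ closedBall (L⁻¹ • x) (R / L) := by
      rw [mem_closedBall, dist_comm, dist_eq_norm]; exact h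
    simp only [sqWell]
    rw [Set.indicator_of_notMem h1, Set.indicator_of_notMem h2, mul_zero]

/-- Upper squeeze: `v^per ≤ K ω₃ (R/L + 1)³`. [folklore] -/
theorem periodizedPotential_sqWell_le {K R L : ℝ} (hK : 0 ≤ K) (hR : 0 ≤ R) (hL : 0 < L) (x : Space) :
    periodizedPotential (sqWell K R) L x ≤ ENNReal.ofReal (K * ((R / L + 1) ^ 3 * ω₃)) := by
  rw [periodizedPotential_sqWell hL, ENNReal.ofReal_mul hK]
  gcongr
  rw [ENNReal.ofReal_mul (by positivity), ← volume_closedBall_one_eq]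
  exact latCount_le _ (by positivity)

/-- Lower squeeze: `K ω₃ (R/L - 1)³ ≤ v^per` when `L ≤ R`. [folklore] -/
theorem le_periodizedPotential_sqWell {K R L : ℝ} (hK : 0 ≤ K) (hL : 0 < L) (hLR : L ≤ R) (x : Space) :
    ENNReal.ofReal (K * ((R / L - 1) ^ 3 * ω₃)) ≤ periodizedPotential (sqWell K R) L x := by
  rw [periodizedPotential_sqWell hL, ENNReal.ofReal_mul hK]
  gcongr
  rw [ENNReal.ofReal_mul (pow_nonneg (by rw [sub_nonneg, one_le_div hL]; exact hLR) 3),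
    ← volume_closedBall_one_eq]
  exact le_latCount _ (by rw [one_le_div hL]; exact hLR)


/-! ## §3 Pair sums: constant bounds on the interaction and on `E₀` -/

/-- Number of ordered pairs `i < j` in `Fin N` (`= N(N-1)/2`; only `≤ N²` is used). [folklore] -/
def pairCount (N : ℕ) : ℕ := ∑ i : Fin N, (Finset.univ.filter fun j : Fin N => i < j).card

/-- `#pairs ≤ N²`. [folklore] -/
theorem pairCount_le (N : ℕ) : pairCount N ≤ N ^ 2 := by
  unfold pairCount
  calc ∑ i : Fin N, (Finset.univ.filter fun j : Fin N => i < j).card ≤ ∑ _i : Fin N, N :=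
        Finset.sum_le_sum fun i _ => (Finset.card_filter_le _ _).trans (by simp)
    _ = N ^ 2 := by simp [sq]

/-- A uniform lower bound on `v^per` bounds the interaction from below. [folklore] -/
theorem le_periodicInteraction_of_le {N : ℕ} {v : ℝ → ℝ≥0∞} {L : ℝ} {a : ℝ≥0∞}
    (h : ∀ y, a ≤ periodizedPotential v L y) (X : Config N) :
    (pairCount N : ℝ≥0∞) * a ≤ periodicInteraction v L X := by
  unfold periodicInteraction pairCount
  push_cast
  rw [Finset.sum_mul]
  refine Finset.sum_le_sum fun i _ => ?_
  rw [← nsmul_eq_mul, ← Finset.sum_const]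
  exact Finset.sum_le_sum fun j _ => h _

/-- A uniform upper bound on `v^per` bounds the interaction from above. [folklore] -/
theorem periodicInteraction_le_of_le {N : ℕ} {v : ℝ → ℝ≥0∞} {L : ℝ} {b : ℝ≥0∞}
    (h : ∀ y, periodizedPotential v L y ≤ b) (X : Config N) :
    periodicInteraction v L X ≤ (pairCount N : ℝ≥0∞) * b := by
  unfold periodicInteraction pairCount
  push_cast
  rw [Finset.sum_mul]
  refine Finset.sum_le_sum fun i _ => ?_
  rw [← nsmul_eq_mul, ← Finset.sum_const]
  exact Finset.sum_le_sum fun j _ => h _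

/-- **`E₀ ≥ #pairs · inf v^per`** (drop the kinetic energy, use the normalisation). [folklore] -/
theorem le_periodicGroundStateEnergy_of_le {N : ℕ} {v : ℝ → ℝ≥0∞} {L : ℝ} {a : ℝ≥0∞}
    (ha : a ≠ ⊤) (h : ∀ y, a ≤ periodizedPotential v L y) :
    (pairCount N : ℝ≥0∞) * a ≤ periodicGroundStateEnergy v N L := by
  refine le_iInf fun Ψ => ?_
  calc (pairCount N : ℝ≥0∞) * a
      = (pairCount N : ℝ≥0∞) * a * ∫⁻ X in cellN N L, (‖Ψ.ψ X‖₊ : ℝ≥0∞) ^ 2 := by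
        rw [Ψ.norm_eq, mul_one]
    _ = ∫⁻ X in cellN N L, (pairCount N : ℝ≥0∞) * a * (‖Ψ.ψ X‖₊ : ℝ≥0∞) ^ 2 :=
        (lintegral_const_mul' _ _ (ENNReal.mul_ne_top (by simp) ha)).symm
    _ ≤ ∫⁻ X in cellN N L,
          kineticDensity Ψ.ψ X + periodicInteraction v L X * (‖Ψ.ψ X‖₊ : ℝ≥0∞) ^ 2 :=
        lintegral_mono fun X => le_add_left (by gcongr; exact le_periodicInteraction_of_le h X)
    _ = periodicEnergy v Ψ := rfl

/-- **Energy of a state with a pointwise kinetic bound**: `E(Ψ) ≤ t + #pairs · sup v^per`.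
[folklore] -/
theorem periodicEnergy_le_of_pointwise {N : ℕ} {v : ℝ → ℝ≥0∞} {L : ℝ} (Ψ : PeriodicTrialState N L)
    {t b : ℝ≥0∞} (ht : t ≠ ⊤) (hb : b ≠ ⊤)
    (hkin : ∀ X, kineticDensity Ψ.ψ X ≤ t * (‖Ψ.ψ X‖₊ : ℝ≥0∞) ^ 2)
    (hpot : ∀ y, periodizedPotential v L y ≤ b) :
    periodicEnergy v Ψ ≤ t + (pairCount N : ℝ≥0∞) * b := by
  calc periodicEnergy v Ψ
      = ∫⁻ X in cellN N L,
          kineticDensity Ψ.ψ X + periodicInteraction v L X * (‖Ψ.ψ X‖₊ : ℝ≥0∞) ^ 2 := rfl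
    _ ≤ ∫⁻ X in cellN N L, (t + (pairCount N : ℝ≥0∞) * b) * (‖Ψ.ψ X‖₊ : ℝ≥0∞) ^ 2 := by
        refine lintegral_mono fun X => ?_
        rw [add_mul]
        gcongr
        · exact hkin X
        · exact periodicInteraction_le_of_le hpot X
    _ = (t + (pairCount N : ℝ≥0∞) * b) * ∫⁻ X in cellN N L, (‖Ψ.ψ X‖₊ : ℝ≥0∞) ^ 2 :=
        lintegral_const_mul' _ _ (ENNReal.add_ne_top.2 ⟨ht, ENNReal.mul_ne_top (by simp) hb⟩)
    _ = t + (pairCount N : ℝ≥0∞) * b := by rw [Ψ.norm_eq, mul_one]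


end Summit.AtomisticToContinuum.BoseEinsteinCondensation.Theorems.DensityResponse.Negative

end
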